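import Mathlib
import Literature.Barriers.ValiantsHypothesis.AlgebraicNaturalProofs
import Literature.Analysis.TotalPositivity.MultiplyPositiveProofs
import Summits.ValiantsHypothesis.ValiantsHypothesis.Theorems.BarrierLeverPartitionMinorsHitByVPAdditiveDoor

/-!
# Route BarrierLever — item `PartitionMinorsHitByVP` (stmt-ValiantsHypothesis-19717):
# the HIDDEN-STATE witness, part 1/2 — its partition coefficients and the Cauchy–Binet leading term

Helper file (`--supports stmt-ValiantsHypothesis-19717`; cell valiant-natproofs, rung V4, 𝒟-side of
door (c); prover seat val-np-p3 gen 6). Definition-free. Closes NO item. Part 2 (`…HiddenStates`) is the door.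

THE WITNESS. With a table `tab : Option κ → σ → ℂ` (row `none` = the shift) and weights `λ : κ → ℂ` on a
finite set `κ` of HIDDEN STATES put

  `F(tab, λ) = ∏_v (1 + tab none v · X_v) · ∏_{k ∈ κ} (1 + λ_k · ∏_v (1 + tab (some k) v · X_v))`.

* `coeff_hiddenStateF` — for every square-free exponent `d`:
  `coeff_d F = Σ_{J ⊆ κ} λ^J · ∏_{s ∈ supp d} (tab none s + Σ_{k ∈ J} tab (some k) s)`
  (expand the state product over the set `J` of states that fire; the `J`-term is ONE product of
  elementary factors indexed by `(insertNone J) × σ`, `AdditiveDoor.coeff_squarefree_prod_one_add_C_mul_X`).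
  On a partition layout (`coeff_partition_hiddenStateF`): `N[U, W] = Σ_J λ^J · α_J^U · β_J^W` with the
  SUBSET-SUM points `α_J = t₀ + Σ_{k∈J} t_k` — BOTH the row set and the column set enter multiplicatively,
  i.e. as the «arbitrary» side of an additive matrix (`…AdditiveCoefficients`), against the common hidden `J`.
* `det_hiddenSum_eq_sum`, `coeff_det_hiddenSum` — CAUCHY–BINET LEADING TERM: for
  `M(t)_{ij} = Σ_k A_{ik} B_{jk} t^{wt k}` and an injective `e : Fin r → ι` whose range is a THRESHOLD family
  (`wt (e i) < wt k` for every `k ∉ range e`), the coefficient of `t^{Σ_i wt (e i)}` in `det M(t)` is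
  `det A[·, e] · det B[·, e]` (tree: `Literature.Analysis.TotalPositivity.det_mul_eq_sum_pi`; non-injective
  selections vanish, other injective selections are strictly heavier, `sum_lt_sum_of_threshold`); hence
  `det M(t₀) ≠ 0` for some `t₀ ∈ ℂ` as soon as both threshold minors are nonzero
  (`exists_eval_det_hiddenSum_ne_zero`, via `Polynomial.funext` over the infinite field `ℂ`).

WHAT THIS IS NOT: pure algebra; no circuits here (part 2); nothing on CPM (items 20172/20195), crux 14610 or
VP vs VNP.
-/

set_option linter.dupNamespace false

namespace Summit.ValiantsHypothesis.ValiantsHypothesis.Theorems.BarrierLever.HiddenStates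

open Finset MvPolynomial Matrix
open Literature.Barriers.ValiantsHypothesis Literature.Computability.AlgebraicComplexity
open Summit.ValiantsHypothesis.ValiantsHypothesis.Theorems.BarrierLever.ProductStateSums
  (castAdd_ne_natAdd partitionExpo_apply_castAdd partitionExpo_apply_natAdd)
open Summit.ValiantsHypothesis.ValiantsHypothesis.Theorems.BarrierLever.AdditiveDoor
  (coeff_squarefree_prod_one_add_C_mul_X truncation_spec degree_partitionExpo_le
    complexity_one_add_C_mul_X_le)

noncomputable section

/-! ## 1. Square-free coefficients of the hidden-state product -/

section Coeff

variable {σ κ : Type*} [Fintype σ] [DecidableEq σ] [Fintype κ] [DecidableEq κ]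

/-- **Coefficients of the hidden-state witness.** For a square-free exponent `d`,
`coeff_d (∏_v (1 + tab none v · X_v) · ∏_k (1 + λ_k ∏_v (1 + tab (some k) v · X_v)))
  = Σ_{J} (∏_{k∈J} λ_k) · ∏_{s ∈ supp d} (tab none s + Σ_{k∈J} tab (some k) s)`. -/
theorem coeff_hiddenStateF (tab : Option κ → σ → ℂ) (lam : κ → ℂ) (d : σ →₀ ℕ) (hd : ∀ t, d t ≤ 1) :
    coeff d ((∏ v : σ, (1 + C (tab none v) * X v)) *
        ∏ k : κ, (1 + C (lam k) * ∏ v : σ, (1 + C (tab (some k) v) * X v)) : MvPolynomial σ ℂ) =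
      ∑ J : Finset κ, (∏ k ∈ J, lam k) * ∏ s ∈ d.support, (tab none s + ∑ k ∈ J, tab (some k) s) := by
  have hexp : (∏ k : κ, (1 + C (lam k) * ∏ v : σ, (1 + C (tab (some k) v) * X v)) : MvPolynomial σ ℂ) =
      ∑ J : Finset κ, C (∏ k ∈ J, lam k) * ∏ k ∈ J, ∏ v : σ, (1 + C (tab (some k) v) * X v) := by
    rw [Finset.prod_one_add, Finset.powerset_univ]
    refine Finset.sum_congr rfl fun J _ => ?_
    rw [Finset.prod_mul_distrib, map_prod]
  rw [hexp, Finset.mul_sum, coeff_sum]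
  refine Finset.sum_congr rfl fun J _ => ?_
  rw [mul_left_comm, coeff_C_mul]
  congr 1
  have hprod : ((∏ v : σ, (1 + C (tab none v) * X v)) *
      ∏ k ∈ J, ∏ v : σ, (1 + C (tab (some k) v) * X v) : MvPolynomial σ ℂ) =
      ∏ e ∈ (Finset.insertNone J) ×ˢ (Finset.univ : Finset σ),
        (1 + C (Function.uncurry tab e) * X (Prod.snd e)) := by
    rw [Finset.prod_product, Finset.prod_insertNone]
    rfl
  rw [hprod, coeff_squarefree_prod_one_add_C_mul_X _ Prod.snd (Function.uncurry tab) d hd]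
  refine Finset.prod_congr rfl fun s _ => ?_
  rw [Finset.sum_filter, Finset.sum_product, Finset.sum_insertNone]
  have hin : ∀ o : Option κ, (∑ v : σ, if Prod.snd (o, v) = s then Function.uncurry tab (o, v) else 0) =
      tab o s := by
    intro o
    simp only [Function.uncurry_apply_pair]
    rw [Finset.sum_ite_eq' Finset.univ s]
    simp
  simp only [hin]

end Coeff

/-! ## 2. The partition exponent: support -/

variable {h : ℕ}

/-- A product over the support of the partition exponent `x^U y^W` splits into its `x`- and `y`-parts. -/
theorem prod_support_partitionExpo (U W : Finset (Fin h)) (g : Fin (h + h) → ℂ) :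
    ∏ s ∈ (∑ a ∈ U, Finsupp.single (Fin.castAdd h a) 1 +
        ∑ c ∈ W, Finsupp.single (Fin.natAdd h c) 1 : Fin (h + h) →₀ ℕ).support, g s =
      (∏ a ∈ U, g (Fin.castAdd h a)) * ∏ c ∈ W, g (Fin.natAdd h c) := by
  set d := (∑ a ∈ U, Finsupp.single (Fin.castAdd h a) 1 +
    ∑ c ∈ W, Finsupp.single (Fin.natAdd h c) 1 : Fin (h + h) →₀ ℕ) with hd
  have hsupp : d.support = U.map (Fin.castAddEmb h) ∪ W.map (Fin.natAddEmb h) := by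
    ext s
    rw [Finsupp.mem_support_iff, Finset.mem_union, Finset.mem_map, Finset.mem_map]
    refine Fin.addCases (fun a => ?_) (fun c => ?_) s
    · rw [hd, partitionExpo_apply_castAdd]
      constructor
      · intro h1
        left
        refine ⟨a, ?_, rfl⟩
        by_contra h2
        rw [if_neg h2] at h1
        exact h1 rfl
      · rintro (⟨a', ha', haa'⟩ | ⟨c', _, hc'⟩)
        · have : a' = a := by
            have := congrArg Fin.val haa'
            simp only [Fin.castAddEmb_apply, Fin.val_castAdd] at this
            exact Fin.ext this
          subst this
          rw [if_pos ha']
          exact one_ne_zero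
        · exact absurd hc' (by
            rw [Fin.natAddEmb_apply]
            exact fun h' => castAdd_ne_natAdd a c' h'.symm)
    · rw [hd, partitionExpo_apply_natAdd]
      constructor
      · intro h1
        right
        refine ⟨c, ?_, rfl⟩
        by_contra h2
        rw [if_neg h2] at h1
        exact h1 rfl
      · rintro (⟨a', _, ha'⟩ | ⟨c', hc', hcc'⟩)
        · exact absurd ha' (by
            rw [Fin.castAddEmb_apply]
            exact castAdd_ne_natAdd a' c)
        · have : c' = c := by
            have := congrArg Fin.val hcc'
            simp only [Fin.natAddEmb_apply, Fin.val_natAdd] at this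
            exact Fin.ext (by omega)
          subst this
          rw [if_pos hc']
          exact one_ne_zero
  have hdisj : Disjoint (U.map (Fin.castAddEmb h)) (W.map (Fin.natAddEmb h)) := by
    rw [Finset.disjoint_left]
    rintro s hs ht
    obtain ⟨a, -, rfl⟩ := Finset.mem_map.mp hs
    obtain ⟨c, -, hc⟩ := Finset.mem_map.mp ht
    rw [Fin.castAddEmb_apply, Fin.natAddEmb_apply] at hc
    exact castAdd_ne_natAdd a c hc.symm
  rw [hsupp, Finset.prod_union hdisj, Finset.prod_map, Finset.prod_map]
  rfl

/-- **The hidden-state partition matrix.** On the layout `(u, w)` the coefficient of `x^{u i} y^{w j}` in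
`F(tab, λ)` is `Σ_J λ^J · ∏_{a ∈ u i} (tab none (x_a) + Σ_{k∈J} tab k (x_a)) · ∏_{c ∈ w j} (…y_c…)`. -/
theorem coeff_partition_hiddenStateF {κ : Type*} [Fintype κ] [DecidableEq κ]
    (tab : Option κ → Fin (h + h) → ℂ) (lam : κ → ℂ) (U W : Finset (Fin h)) :
    coeff (∑ a ∈ U, Finsupp.single (Fin.castAdd h a) 1 + ∑ c ∈ W, Finsupp.single (Fin.natAdd h c) 1)
      ((∏ v : Fin (h + h), (1 + C (tab none v) * X v)) *
        ∏ k : κ, (1 + C (lam k) * ∏ v : Fin (h + h), (1 + C (tab (some k) v) * X v)) :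
        MvPolynomial (Fin (h + h)) ℂ) =
      ∑ J : Finset κ, (∏ k ∈ J, lam k) *
        ((∏ a ∈ U, (tab none (Fin.castAdd h a) + ∑ k ∈ J, tab (some k) (Fin.castAdd h a))) *
          ∏ c ∈ W, (tab none (Fin.natAdd h c) + ∑ k ∈ J, tab (some k) (Fin.natAdd h c))) := by
  rw [coeff_hiddenStateF tab lam _
    (Summit.ValiantsHypothesis.ValiantsHypothesis.Theorems.BarrierLever.AdditiveDoor.partitionExpo_le_one
      U W)]
  refine Finset.sum_congr rfl fun J _ => ?_
  rw [prod_support_partitionExpo]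


/-! ## 3. Cauchy–Binet: the leading coefficient of the hidden sum -/

section Leading

variable {ι : Type*} [Fintype ι] [DecidableEq ι] {r : ℕ}

/-- Expansion of `det M(t)`, `M(t)_{ij} = Σ_k A_{ik} B_{jk} t^{wt k}`, over all selections
`p : Fin r → ι` (Cauchy–Binet with repetitions, `det_mul_eq_sum_pi`). -/
theorem det_hiddenSum_eq_sum (A B : Matrix (Fin r) ι ℂ) (wt : ι → ℕ) :
    (Matrix.of fun i j : Fin r =>
        ∑ k : ι, Polynomial.C (A i k * B j k) * Polynomial.X ^ wt k).det =
      ∑ p : Fin r → ι, Polynomial.C ((∏ i, B i (p i)) * (A.submatrix id p).det) *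
        Polynomial.X ^ (∑ i, wt (p i)) := by
  have hM : (Matrix.of fun i j : Fin r =>
      ∑ k : ι, Polynomial.C (A i k * B j k) * Polynomial.X ^ wt k) =
      (A.map Polynomial.C) * (Matrix.of fun k j => Polynomial.C (B j k) * Polynomial.X ^ wt k) := by
    refine Matrix.ext fun i j => ?_
    rw [Matrix.mul_apply, Matrix.of_apply]
    refine Finset.sum_congr rfl fun k _ => ?_
    rw [Matrix.map_apply, Matrix.of_apply, map_mul]
    ring
  rw [hM, Literature.Analysis.TotalPositivity.det_mul_eq_sum_pi]
  refine Finset.sum_congr rfl fun p _ => ?_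
  simp only [Matrix.of_apply]
  rw [Finset.prod_mul_distrib, ← map_prod Polynomial.C, Finset.prod_pow_eq_pow_sum]
  have hsub : (A.map Polynomial.C).submatrix id p = Polynomial.C.mapMatrix (A.submatrix id p) := rfl
  rw [hsub, ← RingHom.map_det, map_mul]
  ring

omit [Fintype ι] in
/-- An injective selection that is not a reordering of the threshold family `e` is strictly heavier. -/
theorem sum_lt_sum_of_threshold (wt : ι → ℕ) (e p : Fin r → ι) (he : Function.Injective e)
    (hp : Function.Injective p) (hthr : ∀ k, k ∉ Set.range e → ∀ i, wt (e i) < wt k)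
    (hne : p ∉ (Finset.univ : Finset (Equiv.Perm (Fin r))).image
      (fun τ : Equiv.Perm (Fin r) => e ∘ (τ : Fin r → Fin r))) :
    ∑ i, wt (e i) < ∑ i, wt (p i) := by
  classical
  set E : Finset ι := Finset.univ.image e with hE
  set P : Finset ι := Finset.univ.image p with hP
  have hcardE : E.card = r := by rw [hE, Finset.card_image_of_injective _ he, Finset.card_univ, Fintype.card_fin]
  have hcardP : P.card = r := by rw [hP, Finset.card_image_of_injective _ hp, Finset.card_univ, Fintype.card_fin]
  -- `P ≠ E`: otherwise `p` is a reordering of `e`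
  have hPE : ¬ P ⊆ E := by
    intro hsub
    have hmem : ∀ i, ∃ j, e j = p i := fun i => by
      have : p i ∈ E := hsub (Finset.mem_image_of_mem p (Finset.mem_univ i))
      obtain ⟨j, -, hj⟩ := Finset.mem_image.mp this
      exact ⟨j, hj⟩
    choose g hg using hmem
    have hginj : Function.Injective g := fun i i' hii' => hp (by rw [← hg i, ← hg i', hii'])
    have hgbij : Function.Bijective g := Finite.injective_iff_bijective.mp hginj
    apply hne
    refine Finset.mem_image.mpr ⟨Equiv.ofBijective g hgbij, Finset.mem_univ _, ?_⟩
    funext i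
    rw [Function.comp_apply, Equiv.ofBijective_apply, hg i]
  obtain ⟨x₀, hx₀P, hx₀E⟩ := Finset.not_subset.mp hPE
  have hr : 0 < r := by
    rw [← hcardP]; exact Finset.card_pos.mpr ⟨x₀, hx₀P⟩
  have hEne : E.Nonempty := by rw [← Finset.card_pos, hcardE]; exact hr
  obtain ⟨y₀, hy₀, hmax⟩ := Finset.exists_max_image E wt hEne
  -- every element outside `E` is heavier than `wt y₀`
  have hout : ∀ x, x ∉ E → wt y₀ < wt x := by
    intro x hx
    obtain ⟨i₀, -, rfl⟩ := Finset.mem_image.mp hy₀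
    refine hthr x ?_ i₀
    rintro ⟨i, rfl⟩
    exact hx (Finset.mem_image_of_mem e (Finset.mem_univ i))
  -- decompose both sums along `P ∩ E`
  have hsumP : ∑ i, wt (p i) = ∑ x ∈ P, wt x := by
    rw [hP, Finset.sum_image fun i _ i' _ hii' => hp hii']
  have hsumE : ∑ i, wt (e i) = ∑ x ∈ E, wt x := by
    rw [hE, Finset.sum_image fun i _ i' _ hii' => he hii']
  rw [hsumP, hsumE, ← Finset.sum_inter_add_sum_sdiff E P, ← Finset.sum_inter_add_sum_sdiff P E,
    Finset.inter_comm P E]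
  have hcard : (E \ P).card = (P \ E).card := by
    rw [Finset.card_sdiff_eq_card_sdiff_iff]  -- `|E \ P| = |P \ E| ↔ |E| = |P|`?
    rw [hcardE, hcardP]
  have hm : 0 < (P \ E).card := Finset.card_pos.mpr ⟨x₀, Finset.mem_sdiff.mpr ⟨hx₀P, hx₀E⟩⟩
  have h1 : ∑ x ∈ E \ P, wt x ≤ (E \ P).card • wt y₀ :=
    Finset.sum_le_card_nsmul _ _ _ fun x hx => hmax x (Finset.mem_sdiff.mp hx).1
  have h2 : (P \ E).card • (wt y₀ + 1) ≤ ∑ x ∈ P \ E, wt x :=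
    Finset.card_nsmul_le_sum _ _ _ fun x hx => hout x (Finset.mem_sdiff.mp hx).2
  rw [hcard, smul_eq_mul] at h1
  rw [smul_eq_mul] at h2
  have : (P \ E).card * wt y₀ < (P \ E).card * (wt y₀ + 1) := by
    rw [Nat.mul_add, Nat.mul_one]; omega
  omega

/-- **Cauchy–Binet leading term.** If `e` enumerates (injectively) a THRESHOLD family — every index
outside its range is heavier than every index inside — then the coefficient of `t^{Σ_i wt (e i)}` in
`det [Σ_k A_{ik} B_{jk} t^{wt k}]_{ij}` is `det A[·, e] · det B[·, e]`. -/
theorem coeff_det_hiddenSum (A B : Matrix (Fin r) ι ℂ) (wt : ι → ℕ) (e : Fin r → ι)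
    (he : Function.Injective e) (hthr : ∀ k, k ∉ Set.range e → ∀ i, wt (e i) < wt k) :
    ((Matrix.of fun i j : Fin r =>
        ∑ k : ι, Polynomial.C (A i k * B j k) * Polynomial.X ^ wt k).det).coeff (∑ i, wt (e i)) =
      (A.submatrix id e).det * (B.submatrix id e).det := by
  classical
  rw [det_hiddenSum_eq_sum, Polynomial.finsetSum_coeff]
  simp only [Polynomial.coeff_C_mul_X_pow]
  set S : Finset (Fin r → ι) := (Finset.univ : Finset (Equiv.Perm (Fin r))).image
    (fun τ : Equiv.Perm (Fin r) => e ∘ (τ : Fin r → Fin r)) with hS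
  have hterm : ∀ p : Fin r → ι,
      (if (∑ i, wt (e i)) = ∑ i, wt (p i) then (∏ i, B i (p i)) * (A.submatrix id p).det else 0) =
        if p ∈ S then (∏ i, B i (p i)) * (A.submatrix id p).det else 0 := by
    intro p
    by_cases hpS : p ∈ S
    · obtain ⟨τ, -, rfl⟩ := Finset.mem_image.mp hpS
      rw [if_pos hpS, if_pos]
      exact (Equiv.sum_comp τ (fun i => wt (e i))).symm
    · rw [if_neg hpS]
      by_cases hinj : Function.Injective p
      · rw [if_neg]
        exact (sum_lt_sum_of_threshold wt e p he hinj hthr hpS).ne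
      · rw [Literature.Analysis.TotalPositivity.det_submatrix_eq_zero_of_not_injective A hinj,
          mul_zero, ite_self]
  rw [Finset.sum_congr rfl fun p _ => hterm p, Finset.sum_ite_mem, Finset.univ_inter, hS,
    Finset.sum_image fun (τ : Equiv.Perm (Fin r)) _ (τ' : Equiv.Perm (Fin r)) _
      (hττ' : e ∘ (τ : Fin r → Fin r) = e ∘ (τ' : Fin r → Fin r)) =>
      Equiv.ext fun i => he (congrFun hττ' i)]
  -- `Σ_σ (∏_i B_{i, e σ i}) · det A[·, e ∘ σ] = det A[·,e] · det B[·,e]`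
  have hA : ∀ τ : Equiv.Perm (Fin r),
      (A.submatrix id (e ∘ (τ : Fin r → Fin r))).det =
        Equiv.Perm.sign τ * (A.submatrix id e).det := fun τ => by
    have : A.submatrix id (e ∘ (τ : Fin r → Fin r)) = (A.submatrix id e).submatrix id τ := rfl
    rw [this, Matrix.det_permute']
  simp_rw [Function.comp_apply, hA]
  rw [← Matrix.det_transpose (B.submatrix id e), Matrix.det_apply' (B.submatrix id e)ᵀ, Finset.mul_sum]
  refine Finset.sum_congr rfl fun τ _ => ?_
  simp only [Matrix.transpose_apply, Matrix.submatrix_apply, id]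
  ring

/-- Hence, if both threshold minors are nonzero, some numeric weight `t₀` makes the hidden sum
nonsingular (a nonzero polynomial over `ℂ` has a non-root). -/
theorem exists_eval_det_hiddenSum_ne_zero (A B : Matrix (Fin r) ι ℂ) (wt : ι → ℕ) (e : Fin r → ι)
    (he : Function.Injective e) (hthr : ∀ k, k ∉ Set.range e → ∀ i, wt (e i) < wt k)
    (hA : (A.submatrix id e).det ≠ 0) (hB : (B.submatrix id e).det ≠ 0) :
    ∃ t₀ : ℂ, (Matrix.of fun i j : Fin r => ∑ k : ι, A i k * B j k * t₀ ^ wt k).det ≠ 0 := by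
  classical
  set M : Matrix (Fin r) (Fin r) (Polynomial ℂ) := Matrix.of fun i j : Fin r =>
    ∑ k : ι, Polynomial.C (A i k * B j k) * Polynomial.X ^ wt k with hM
  have hdet : M.det ≠ 0 := by
    intro h0
    have hc := coeff_det_hiddenSum A B wt e he hthr
    rw [← hM, h0, Polynomial.coeff_zero] at hc
    exact mul_ne_zero hA hB hc.symm
  by_contra hall
  push Not at hall
  apply hdet
  refine Polynomial.funext fun t₀ => ?_
  rw [Polynomial.eval_zero]
  have hev : (M.det).eval t₀ =
      (Matrix.of fun i j : Fin r => ∑ k : ι, A i k * B j k * t₀ ^ wt k).det := by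
    rw [← Polynomial.coe_evalRingHom, RingHom.map_det, RingHom.mapMatrix_apply]
    congr 1
    refine Matrix.ext fun i j => ?_
    simp only [hM, Matrix.map_apply, Matrix.of_apply, Polynomial.coe_evalRingHom, Polynomial.eval_finsetSum,
      Polynomial.eval_mul, Polynomial.eval_C, Polynomial.eval_pow, Polynomial.eval_X]
  rw [hev]
  exact hall t₀

end Leading

end

end Summit.ValiantsHypothesis.ValiantsHypothesis.Theorems.BarrierLever.HiddenStates
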